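import Literature.NumberTheory.Sieve.LinearEquationsInPrimesQualitative
import Literature.NumberTheory.Sieve.PrimeParallelograms
import HarnessLib

/-!
# Green–Tao 2010, Example 8 at `k = 3` (van der Corput's theorem with the Hardy–Littlewood constant) — I: the system, the count, the local factors

Topic `Literature/NumberTheory/Sieve`. Source: B. Green, T. Tao, *Linear equations in primes*,
Ann. of Math. 171 (2010), §1 Example 8 (arXiv:math/0606088 p. 7): "Let `k ≥ 2` be a fixed
integer. Assume the `GI(k−2)` conjecture and the `MN(k−2)` conjecture. Then the number of
`k`-tuples of primes `p₁ < p₂ < ⋯ < p_k ≤ N` which lie in arithmetic progression is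
`(1/(2(k−1)) ∏_p β_p + o_k(1)) N²/log^k N`, where `β_p = (1/p)(p/(p−1))^{k−1}` if `p ≤ k` and
`β_p = (1 − (k−1)/p)(p/(p−1))^{k−1}` if `p ≥ k`. … the `k = 3` case is due to van der Corput."

At `k = 3` the hypotheses `GI(1)`, `MN(1)` are classical (loc. cit. §1), and the tree proves the
counting form (1.8) at complexity `1` (`GreenTao2010_primePointCountAtComplexity_one`). This file
sets up the `k = 3` instance:

* `threeAPSystem = (n₁, n₁ + n₂, n₁ + 2n₂)` (`= ` the `k = 1` case of `complexity_arithProg`):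
  complexity `1`, nondegenerate, `‖Ψ‖_N = 6`;
* `primeThreeAPCount N = #{p₁ < p₂ < p₃ ≤ N primes in arithmetic progression}` and
  `primeThreeAPCount_eq`: it is the prime-point count of `threeAPSystem` on the triangle
  `threeAPRegion N = {1 ≤ x, 1 ≤ y, x + 2y ≤ N}` (`(n₁, n₂) ↦ (n₁, n₁ + n₂, n₁ + 2n₂)`);
* `localFactor_threeAPSystem`: `β₂ = 2` and `β_p = p(p−2)/(p−1)² = (1 − 2/p)(p/(p−1))²` for odd
  primes `p` (the count `#{(a, b) ∈ 𝔽_p² : a, a+b, a+2b ≠ 0} = (p−1)(p−2)`).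

The asymptotic itself (`β_∞ = vol = (N−3)²/4` and the bookkeeping) is part II.

## References

* [GreenTao2010] B. Green, T. Tao, *Linear equations in primes*, Ann. of Math. (2) 171 (2010),
  §1 Example 8, Examples 1 (complexity of progressions), (1.6).
-/

noncomputable section

open Finset

namespace Literature.NumberTheory.Sieve

/-! ### The system `(n₁, n₁ + n₂, n₁ + 2n₂)` -/

/-- The system `Ψ(n₁, n₂) = (n₁, n₁ + n₂, n₁ + 2n₂)` counting three-term progressions.
[cite: GreenTao2010, Examples 1] -/
def threeAPSystem : Fin 3 → AffLinForm 2 := fun i => ⟨![1, (i : ℤ)], 0⟩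

/-- It has complexity `1`. [cite: GreenTao2010, Examples 1] -/
theorem complexity_threeAPSystem : complexity threeAPSystem = (1 : ℕ) := complexity_arithProg 1

/-- It has finite complexity (no two forms parallel). [cite: GreenTao2010, Examples 1] -/
theorem isFiniteComplexitySystem_threeAPSystem : IsFiniteComplexitySystem threeAPSystem :=
  isFiniteComplexitySystem_arithProg 3

/-- It is nondegenerate. [cite: GreenTao2010, Examples 1] -/
theorem isNondegenerateSystem_threeAPSystem : IsNondegenerateSystem threeAPSystem :=
  isNondegenerateSystem_of_complexity_le (s := 1) complexity_threeAPSystem.le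

/-- `ψᵢ(n) = n₁ + i n₂`. [cite: GreenTao2010, Examples 1] -/
@[simp] theorem eval_threeAPSystem (i : Fin 3) (n : Fin 2 → ℤ) :
    (threeAPSystem i).eval n = n 0 + (i : ℤ) * n 1 := by
  simp [threeAPSystem, AffLinForm.eval, Fin.sum_univ_two]

/-- `ψᵢ(x) = x₁ + i x₂` over `ℝ`. [cite: GreenTao2010, Examples 1] -/
@[simp] theorem realEval_threeAPSystem (i : Fin 3) (x : Fin 2 → ℝ) :
    (threeAPSystem i).realEval x = x 0 + (i : ℝ) * x 1 := by
  simp [threeAPSystem, AffLinForm.realEval, Fin.sum_univ_two]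

/-- `ψᵢ mod p (v) = v₁ + i v₂`. [cite: GreenTao2010, Examples 1] -/
@[simp] theorem modEval_threeAPSystem (p : ℕ) (i : Fin 3) (v : Fin 2 → ZMod p) :
    (threeAPSystem i).modEval p v = v 0 + ((i : ℕ) : ZMod p) * v 1 := by
  simp [threeAPSystem, AffLinForm.modEval, Fin.sum_univ_two]

/-- `‖Ψ‖_N = 6` at every scale. [cite: GreenTao2010, (1.1)] -/
theorem affLinSize_threeAPSystem (N : ℝ) : affLinSize threeAPSystem N = 6 := by
  simp [affLinSize, threeAPSystem, Fin.sum_univ_three, Fin.sum_univ_two]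
  norm_num

/-! ### The count of three-term progressions of primes up to `N` -/

/-- The triangle `{(x, y) : 1 ≤ x, 1 ≤ y, x + 2y ≤ N}` (so that `(n₁, n₁+n₂, n₁+2n₂)` runs over
increasing triples `≤ N`). [cite: GreenTao2010, §1 Example 8] -/
def threeAPRegion (N : ℕ) : Set (Fin 2 → ℝ) :=
  {v | 1 ≤ v 0 ∧ 1 ≤ v 1 ∧ v 0 + 2 * v 1 ≤ N}

/-- The triangle is convex. [cite: GreenTao2010, §1 Example 8] -/
theorem convex_threeAPRegion (N : ℕ) : Convex ℝ (threeAPRegion N) := by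
  intro x hx y hy a b ha hb hab
  obtain ⟨hx0, hx1, hx2⟩ := hx
  obtain ⟨hy0, hy1, hy2⟩ := hy
  simp only [threeAPRegion, Set.mem_setOf_eq, Pi.add_apply, Pi.smul_apply, smul_eq_mul]
  refine ⟨?_, ?_, ?_⟩
  · calc (1 : ℝ) = a * 1 + b * 1 := by rw [mul_one, mul_one, hab]
      _ ≤ a * x 0 + b * y 0 := add_le_add (mul_le_mul_of_nonneg_left hx0 ha)
          (mul_le_mul_of_nonneg_left hy0 hb)
  · calc (1 : ℝ) = a * 1 + b * 1 := by rw [mul_one, mul_one, hab]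
      _ ≤ a * x 1 + b * y 1 := add_le_add (mul_le_mul_of_nonneg_left hx1 ha)
          (mul_le_mul_of_nonneg_left hy1 hb)
  · calc a * x 0 + b * y 0 + 2 * (a * x 1 + b * y 1)
        = a * (x 0 + 2 * x 1) + b * (y 0 + 2 * y 1) := by ring
      _ ≤ a * N + b * N := add_le_add (mul_le_mul_of_nonneg_left hx2 ha)
          (mul_le_mul_of_nonneg_left hy2 hb)
      _ = N := by rw [← add_mul, hab, one_mul]

/-- The triangle lies in `[−N, N]²`. [cite: GreenTao2010, §1 Example 8] -/
theorem threeAPRegion_subset_realBox (N : ℕ) : threeAPRegion N ⊆ realBox 2 (N : ℝ) := by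
  intro v hv
  obtain ⟨h0, h1, h2⟩ := hv
  have hN : (0 : ℝ) ≤ N := Nat.cast_nonneg N
  refine ⟨fun j => ?_, fun j => ?_⟩
  · fin_cases j <;> simp <;> linarith
  · fin_cases j <;> simp <;> linarith

/-- On the triangle every form of the system is positive. [cite: GreenTao2010, §1 Example 8] -/
theorem realEval_threeAPSystem_pos {N : ℕ} {v : Fin 2 → ℝ} (hv : v ∈ threeAPRegion N) (i : Fin 3) :
    0 < (threeAPSystem i).realEval v := by
  obtain ⟨h0, h1, -⟩ := hv
  rw [realEval_threeAPSystem]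
  have : (0 : ℝ) ≤ (i : ℝ) * v 1 := mul_nonneg (Nat.cast_nonneg _) (by linarith)
  linarith

/-- **The number of triples of primes `p₁ < p₂ < p₃ ≤ N` in arithmetic progression**
(`p₁ + p₃ = 2p₂`). [cite: GreenTao2010, §1 Example 8] -/
def primeThreeAPCount (N : ℕ) : ℕ :=
  #((range (N + 1) ×ˢ (range (N + 1) ×ˢ range (N + 1))).filter fun q =>
      q.1 < q.2.1 ∧ q.2.1 < q.2.2 ∧ q.1.Prime ∧ q.2.1.Prime ∧ q.2.2.Prime ∧ q.1 + q.2.2 = 2 * q.2.1)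

/-- [folklore] -/
private theorem forall_fin_three {P : Fin 3 → Prop} : (∀ i, P i) ↔ P 0 ∧ P 1 ∧ P 2 :=
  ⟨fun h => ⟨h 0, h 1, h 2⟩, fun h i => by fin_cases i; exacts [h.1, h.2.1, h.2.2]⟩

/-- [folklore] -/
private theorem mem_latticeBox_two {N : ℕ} {n : Fin 2 → ℤ} :
    n ∈ latticeBox 2 N ↔ (-(N : ℤ) ≤ n 0 ∧ n 0 ≤ N) ∧ (-(N : ℤ) ≤ n 1 ∧ n 1 ≤ N) := by
  unfold latticeBox
  rw [Fintype.mem_piFinset, Fin.forall_fin_two, Finset.mem_Icc, Finset.mem_Icc]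

/-- [folklore] -/
private theorem realPoint_mem_threeAPRegion {N : ℕ} {n : Fin 2 → ℤ} :
    realPoint n ∈ threeAPRegion N ↔ 1 ≤ n 0 ∧ 1 ≤ n 1 ∧ n 0 + 2 * n 1 ≤ N := by
  simp only [threeAPRegion, realPoint, Set.mem_setOf_eq]
  refine ⟨fun ⟨h0, h1, h2⟩ => ⟨by exact_mod_cast h0, by exact_mod_cast h1, by exact_mod_cast h2⟩,
    fun ⟨h0, h1, h2⟩ => ⟨by exact_mod_cast h0, by exact_mod_cast h1, by exact_mod_cast h2⟩⟩

/-- **The progression count is the prime-point count of `(n₁, n₁+n₂, n₁+2n₂)` on the triangle**,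
via `(n₁, n₂) ↦ (n₁, n₁ + n₂, n₁ + 2n₂)`. [cite: GreenTao2010, §1 Example 8] -/
theorem primeThreeAPCount_eq (N : ℕ) :
    primeThreeAPCount N = primePointCount threeAPSystem (threeAPRegion N) N := by
  classical
  unfold primeThreeAPCount primePointCount
  symm
  refine Finset.card_nbij'
    (fun n => ((n 0).toNat, ((n 0 + n 1).toNat, (n 0 + 2 * n 1).toNat)))
    (fun q => ![(q.1 : ℤ), (q.2.1 : ℤ) - q.1]) ?_ ?_ ?_ ?_
  · intro n hn
    rw [Finset.mem_coe, Finset.mem_filter, realPoint_mem_threeAPRegion, forall_fin_three] at hn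
    obtain ⟨-, ⟨h0, h1, h2⟩, hp0, hp1, hp2⟩ := hn
    simp only [eval_threeAPSystem, Fin.val_zero, Nat.cast_zero, zero_mul, add_zero, Fin.val_one,
      Nat.cast_one, one_mul, Fin.val_two, Nat.cast_ofNat] at hp0 hp1 hp2
    simp only [Finset.mem_coe, Finset.mem_filter, Finset.mem_product, Finset.mem_range]
    refine ⟨⟨by omega, by omega, by omega⟩, by omega, by omega, hp0, hp1, hp2, by omega⟩
  · intro q hq
    rw [Finset.mem_coe, Finset.mem_filter, Finset.mem_product, Finset.mem_product,
      Finset.mem_range, Finset.mem_range, Finset.mem_range] at hq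
    obtain ⟨⟨ha, hb, hc⟩, hab, hbc, hpa, hpb, hpc, hsum⟩ := hq
    have ha2 := hpa.two_le
    rw [Finset.mem_coe, Finset.mem_filter, mem_latticeBox_two, realPoint_mem_threeAPRegion,
      forall_fin_three]
    simp only [eval_threeAPSystem, Fin.val_zero, Nat.cast_zero, zero_mul, add_zero, Fin.val_one,
      Nat.cast_one, one_mul, Fin.val_two, Nat.cast_ofNat, Matrix.cons_val_zero,
      Matrix.cons_val_one]
    have hc' : (q.1 : ℤ) + 2 * ((q.2.1 : ℤ) - q.1) = q.2.2 := by
      have := congrArg (Nat.cast : ℕ → ℤ) hsum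
      push_cast at this
      linarith
    refine ⟨⟨⟨by omega, by omega⟩, by omega, by omega⟩, ⟨by omega, by omega, by omega⟩, ?_, ?_, ?_⟩
    · rw [Int.toNat_natCast]; exact hpa
    · rw [show (q.1 : ℤ) + ((q.2.1 : ℤ) - q.1) = q.2.1 by ring, Int.toNat_natCast]; exact hpb
    · rw [hc', Int.toNat_natCast]; exact hpc
  · intro n hn
    rw [Finset.mem_coe, Finset.mem_filter, realPoint_mem_threeAPRegion] at hn
    obtain ⟨-, ⟨h0, h1, -⟩, -⟩ := hn
    funext j
    fin_cases j
    · simp only [Fin.zero_eta, Matrix.cons_val_zero]; omega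
    · simp; omega
  · intro q hq
    rw [Finset.mem_coe, Finset.mem_filter, Finset.mem_product, Finset.mem_product] at hq
    obtain ⟨-, hab, hbc, hpa, -, -, hsum⟩ := hq
    simp only [Matrix.cons_val_zero, Matrix.cons_val_one, Int.toNat_natCast]
    refine Prod.ext rfl (Prod.ext ?_ ?_)
    · show ((q.1 : ℤ) + ((q.2.1 : ℤ) - q.1)).toNat = q.2.1; omega
    · show ((q.1 : ℤ) + 2 * ((q.2.1 : ℤ) - q.1)).toNat = q.2.2; omega

/-! ### The local factors `β_p` -/

/-- `β_p` of Example 8 at `k = 3`: `β₂ = 2` and `β_p = (1 − 2/p)(p/(p−1))² = p(p−2)/(p−1)²` for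
`p ≥ 3`. [cite: GreenTao2010, §1 Example 8] -/
def threeAPLocalFactor (p : ℕ) : ℝ :=
  if p = 2 then 2 else (p : ℝ) * (p - 2) / ((p : ℝ) - 1) ^ 2

/-- `Λ_{ℤ/p}` at a prime: `p/(p−1)` off zero, `0` at zero. [cite: GreenTao2010, (1.5)] -/
theorem localVonMangoldtZMod_prime {p : ℕ} (hp : p.Prime) (x : ZMod p) :
    localVonMangoldtZMod p x = if x = 0 then 0 else (p : ℝ) / ((p : ℝ) - 1) := by
  haveI := Fact.mk hp
  unfold localVonMangoldtZMod
  rw [Nat.totient_prime hp, Nat.cast_pred hp.pos]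
  by_cases hx : x = 0
  · simp [hx]
  · rw [if_pos (isUnit_iff_ne_zero.mpr hx), if_neg hx]

/-- The integrand `∏ᵢ Λ_{ℤ/p}(ψᵢ(v))` of `β_p` for the progression system: `(p/(p−1))³` if
`v₁, v₁ + v₂, v₁ + 2v₂` are all non-zero, else `0`. [cite: GreenTao2010, (1.6)] -/
theorem prod_localVonMangoldtZMod_threeAPSystem {p : ℕ} (hp : p.Prime) (v : Fin 2 → ZMod p) :
    ∏ i, localVonMangoldtZMod p ((threeAPSystem i).modEval p v) =
      if v 0 ≠ 0 ∧ v 0 + v 1 ≠ 0 ∧ v 0 + 2 * v 1 ≠ 0 then ((p : ℝ) / ((p : ℝ) - 1)) ^ 3 else 0 := by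
  rw [Fin.prod_univ_three]
  simp only [modEval_threeAPSystem, localVonMangoldtZMod_prime hp, Fin.val_zero, Nat.cast_zero,
    zero_mul, add_zero, Fin.val_one, Nat.cast_one, one_mul, Fin.val_two, Nat.cast_ofNat]
  by_cases h0 : v 0 = 0 <;> by_cases h1 : v 0 + v 1 = 0 <;> by_cases h2 : v 0 + 2 * v 1 = 0 <;>
    (simp [h0, h1, h2]; try ring)

/-- [folklore] -/
private theorem threeAP_key_two :
    ∀ q : ZMod 2 × ZMod 2, (q.1 ≠ 0 ∧ q.1 + q.2 ≠ 0 ∧ q.1 + 2 * q.2 ≠ 0) ↔ q = (1, 0) := by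
  decide

/-- For an odd prime `p` and `a ≠ 0`: `#{b ∈ 𝔽_p : a + b ≠ 0, a + 2b ≠ 0} = p − 2` (the two
excluded values `−a`, `−a/2` are distinct). [cite: GreenTao2010, §1 Example 8] -/
theorem card_filter_threeAP_fibre {p : ℕ} [NeZero p] (hp : p.Prime) (hp2 : p ≠ 2) {a : ZMod p}
    (ha : a ≠ 0) :
    #((Finset.univ : Finset (ZMod p)).filter fun b => a + b ≠ 0 ∧ a + 2 * b ≠ 0) = p - 2 := by
  classical
  haveI := Fact.mk hp
  have h2 : (2 : ZMod p) ≠ 0 := by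
    intro h
    have h' : ((2 : ℕ) : ZMod p) = 0 := by exact_mod_cast h
    rw [ZMod.natCast_eq_zero_iff] at h'
    exact hp2 ((Nat.prime_dvd_prime_iff_eq hp Nat.prime_two).mp h')
  -- the complement has exactly the two elements `-a` and `-a/2`
  have hbad : (Finset.univ : Finset (ZMod p)).filter (fun b => ¬ (a + b ≠ 0 ∧ a + 2 * b ≠ 0)) =
      {-a, -a * 2⁻¹} := by
    ext b
    simp only [Finset.mem_filter, Finset.mem_univ, true_and, not_and_or, not_not,
      Finset.mem_insert, Finset.mem_singleton]
    constructor
    · rintro (h | h)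
      · left; linear_combination h
      · right
        calc b = 2⁻¹ * (2 * b) := by rw [← mul_assoc, inv_mul_cancel₀ h2, one_mul]
          _ = -a * 2⁻¹ := by rw [show 2 * b = -a by linear_combination h]; ring
    · rintro (rfl | rfl)
      · left; ring
      · right
        calc a + 2 * (-a * 2⁻¹) = a - a * (2 * 2⁻¹) := by ring
          _ = 0 := by rw [mul_inv_cancel₀ h2]; ring
  have hne : -a ≠ -a * 2⁻¹ := by
    intro h
    apply ha
    have h' := congrArg (· * (2 : ZMod p)) h
    simp only [mul_assoc, inv_mul_cancel₀ h2, mul_one] at h'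
    linear_combination -h'
  have hcount := Finset.card_filter_add_card_filter_not (s := (Finset.univ : Finset (ZMod p)))
    (fun b => a + b ≠ 0 ∧ a + 2 * b ≠ 0)
  rw [hbad, Finset.card_pair hne, Finset.card_univ, ZMod.card] at hcount
  omega

/-- **`β_p` of the progression system** (Green–Tao's Example 8 values at `k = 3`): `β₂ = 2`,
`β_p = p(p−2)/(p−1)²` for odd primes. [cite: GreenTao2010, §1 Example 8, (1.6)] -/
theorem localFactor_threeAPSystem {p : ℕ} (hp : p.Prime) :
    localFactor threeAPSystem p = threeAPLocalFactor p := by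
  classical
  haveI := Fact.mk hp
  haveI : NeZero p := ⟨hp.ne_zero⟩
  set C : ℝ := ((p : ℝ) / ((p : ℝ) - 1)) ^ 3 with hC
  have hp1 : (p : ℝ) - 1 ≠ 0 := by
    have : (2 : ℝ) ≤ p := by exact_mod_cast hp.two_le
    linarith
  have hp0 : (p : ℝ) ≠ 0 := by exact_mod_cast hp.ne_zero
  -- `β_p = p^{-2} ∑_{(a,b) ∈ 𝔽_p²} [a, a+b, a+2b ≠ 0] C`
  have hconv : ∑ v : Fin 2 → ZMod p, ∏ i, localVonMangoldtZMod p ((threeAPSystem i).modEval p v) =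
      ∑ q : ZMod p × ZMod p, if q.1 ≠ 0 ∧ q.1 + q.2 ≠ 0 ∧ q.1 + 2 * q.2 ≠ 0 then C else 0 := by
    refine Fintype.sum_equiv (finTwoArrowEquiv (ZMod p)) _ _ fun v => ?_
    rw [prod_localVonMangoldtZMod_threeAPSystem hp]
    simp [finTwoArrowEquiv, hC]
  rw [localFactor_eq_sum_zmod, hconv]
  by_cases hp2 : p = 2
  · subst hp2
    unfold threeAPLocalFactor
    rw [if_pos rfl]
    simp_rw [threeAP_key_two]
    rw [Finset.sum_ite_eq', if_pos (Finset.mem_univ _), hC]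
    norm_num
  · unfold threeAPLocalFactor
    rw [if_neg hp2, Fintype.sum_prod_type]
    have hinner : ∀ a : ZMod p,
        (∑ b : ZMod p, if a ≠ 0 ∧ a + b ≠ 0 ∧ a + 2 * b ≠ 0 then C else (0 : ℝ)) =
          if a = 0 then 0 else ((p : ℝ) - 2) * C := by
      intro a
      by_cases ha : a = 0
      · simp [ha]
      · rw [if_neg ha]
        have e : ∀ b : ZMod p, (if a ≠ 0 ∧ a + b ≠ 0 ∧ a + 2 * b ≠ 0 then C else (0 : ℝ)) =
            if (a + b ≠ 0 ∧ a + 2 * b ≠ 0) then C else 0 := by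
          intro b; simp [ha]
        simp_rw [e]
        rw [Finset.sum_ite, Finset.sum_const_zero, add_zero, Finset.sum_const,
          card_filter_threeAP_fibre hp hp2 ha, nsmul_eq_mul, Nat.cast_sub hp.two_le]
        push_cast
        ring
    simp_rw [hinner]
    rw [Finset.sum_ite, Finset.sum_const_zero, zero_add, Finset.sum_const, nsmul_eq_mul]
    have hcard : #((Finset.univ : Finset (ZMod p)).filter fun a => ¬ a = 0) = p - 1 := by
      rw [Finset.filter_ne' Finset.univ (0 : ZMod p), Finset.card_erase_of_mem (Finset.mem_univ _),
        Finset.card_univ, ZMod.card]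
    rw [hcard, Nat.cast_sub hp.one_le, hC]
    push_cast
    field_simp

/-- The partial singular products are the explicit Euler factors of Example 8.
[cite: GreenTao2010, §1 Example 8] -/
theorem singularProductPartial_threeAPSystem (x : ℕ) :
    singularProductPartial threeAPSystem x = ∏ p ∈ Nat.primesLE x, threeAPLocalFactor p := by
  unfold singularProductPartial
  exact Finset.prod_congr rfl fun p hp => localFactor_threeAPSystem (Nat.prime_of_mem_primesLE hp)

/-- No local obstruction: `∏_p β_p > 0` (witness `(1, 0)`: all forms equal `1`).
[cite: GreenTao2010, Cor. 1.9, §1 Example 8] -/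
theorem singularProduct_threeAPSystem_pos : 0 < singularProduct threeAPSystem :=
  singularProduct_pos_of_locallySolvable _ isNondegenerateSystem_threeAPSystem fun p hp =>
    ⟨![1, 0], fun i => by
      rw [eval_threeAPSystem]
      simp only [Matrix.cons_val_zero, Matrix.cons_val_one, mul_zero, add_zero]
      intro h
      have h1 : (p : ℤ) ∣ ((1 : ℕ) : ℤ) := by simpa using h
      exact hp.one_lt.ne' (Nat.dvd_one.mp (Int.natCast_dvd_natCast.mp h1))⟩

end Literature.NumberTheory.Sieve

end
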